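import Mathlib
import Summits.ValiantsHypothesis.ValiantsHypothesis.Theorems.RigidityForcesSymmetryRankRigidMinimalReprLaplaceFiveSeparatedCaptureSymmetricPieces
import Summits.ValiantsHypothesis.ValiantsHypothesis.Theorems.RigidityForcesSymmetryRankRigidMinimalReprLaplaceFiveSeparatedCaptureTwoTerm
import Summits.ValiantsHypothesis.ValiantsHypothesis.Theorems.RigidityForcesSymmetryRankRigidMinimalReprLaplaceFiveSeparatedCaptureLeadingMonomials

/-!
# ValiantsHypothesis / RigidityForcesSymmetry — crux `LaplaceOptimalFive` (stmt-ValiantsHypothesis-24813), symmetric capture: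
# **TWO TRIANGLE DIRECTIONS: `CaptureIneqSym` with `U₁₂ = ⊥` IS A THEOREM** (profiles `(r₁, r₂, 0)`)

If only two of the three triangle cuts carry short factors (`U₁₂ = ⊥`, the other two spans symmetric of ANY dimension), every captured
obligation `T_μ = A_r(p,q) + B_q(p,r)` (✓ `L3_finite_form`) splits into two FULLY SYMMETRIC pieces: the slot symmetry `(0 1)` of `T_μ`
(✓ `contractZ_swap12`) and the symmetry of the matrices `A_r` give `B_q(p,r) = B_p(q,r)`, so `(p,q,r) ↦ B_q(p,r)` is symmetric, hence so
is `(p,q,r) ↦ A_r(p,q)`.  This is the `Ω = 0` situation of ✓ `capture_of_symmetric_pieces` (the hub / Lemma W), whence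
`finrank W ≤ finrank (U₀₁ ⊔ U₀₂) ≤ finrank U₀₁ + finrank U₀₂` — the inequality `CaptureIneqSym` for every profile `(r₁, r₂, 0)`
(✓ `capture_one_direction` is `(r, 0, 0)`).

* `placed01_mem_L3`, `placed02_mem_L3` — the placed tuples lie in `L₃(U,⊥,⊥)`, `L₃(⊥,U,⊥)`.
* ★★ `captureIneqSym_of_third_bot` — the theorem.

Honest framing.  A SUB-CASE (one empty triangle cut) of the OPEN inequality `CaptureIneqSym`; three non-trivial directions, K1 on
`K₃ ⊔ K₂` in general, S2′, `LaplaceOptimalFive` (OPEN · CONTESTED 72/120), `VP ≠ VNP` are NOT proved.  No definitions, no `sorry`.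
-/

set_option linter.dupNamespace false
set_option autoImplicit false

namespace Summit.ValiantsHypothesis.ValiantsHypothesis.Theorems.RigidityForcesSymmetryRankRigidMinimalRepr

namespace LaplaceFiveSeparatedCapture

open Finset LaplaceFiveSectorSplit

/-- A tuple `A : Fin 5 → U` placed on the slots `(0,1 | 2)` lies in `L₃(U, ⊥, ⊥)`. [folklore] -/
theorem placed01_mem_L3 (U V V' : Submodule ℂ (Fin 5 → Fin 5 → ℂ)) (A : Fin 5 → Fin 5 → Fin 5 → ℂ) (hA : ∀ r, A r ∈ U) :
    (fun p q r => A r p q) ∈ L3 U V V' := by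
  classical
  have h : (fun p q r => A r p q) = ∑ r₀ : Fin 5, fun p q r => A r₀ p q * (if r = r₀ then (1 : ℂ) else 0) := by
    funext p q r
    simp only [Finset.sum_apply, mul_ite, mul_one, mul_zero, Finset.sum_ite_eq, Finset.mem_univ, if_true]
  rw [h]
  refine Submodule.sum_mem _ fun r₀ _ => Submodule.subset_span (Or.inl (Or.inl ⟨A r₀, hA r₀, _, rfl⟩))

/-- A tuple `B : Fin 5 → U` placed on the slots `(0,2 | 1)` lies in `L₃(⊥, U, ⊥)` (any first/third spans). [folklore] -/
theorem placed02_mem_L3 (V U V' : Submodule ℂ (Fin 5 → Fin 5 → ℂ)) (B : Fin 5 → Fin 5 → Fin 5 → ℂ) (hB : ∀ q, B q ∈ U) :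
    (fun p q r => B q p r) ∈ L3 V U V' := by
  classical
  have h : (fun p q r => B q p r) = ∑ q₀ : Fin 5, fun p q r => B q₀ p r * (if q = q₀ then (1 : ℂ) else 0) := by
    funext p q r
    simp only [Finset.sum_apply, mul_ite, mul_one, mul_zero, Finset.sum_ite_eq, Finset.mem_univ, if_true]
  rw [h]
  refine Submodule.sum_mem _ fun q₀ _ => Submodule.subset_span (Or.inl (Or.inr ⟨B q₀, hB q₀, _, rfl⟩))

/-- ★★ **`CaptureIneqSym` FOR TWO TRIANGLE DIRECTIONS (`U₁₂ = ⊥`).**  With symmetric spans `U₀₁, U₀₂` of any dimension and no short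
factor on the third cut, every captured space `W` of symmetric zero-diagonal leaf matrices has
`finrank W ≤ finrank U₀₁ + finrank U₀₂`. [folklore] -/
theorem captureIneqSym_of_third_bot (U01 U02 W : Submodule ℂ (Fin 5 → Fin 5 → ℂ))
    (hs01 : ∀ u ∈ U01, ∀ p q : Fin 5, u p q = u q p) (hs02 : ∀ u ∈ U02, ∀ p q : Fin 5, u p q = u q p)
    (hWs : ∀ μ ∈ W, ∀ s t : Fin 5, μ s t = μ t s) (hWd : ∀ μ ∈ W, ∀ s : Fin 5, μ s s = 0)
    (hWc : ∀ μ ∈ W, contractZ μ ∈ L3 U01 U02 ⊥) :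
    Module.finrank ℂ W ≤ Module.finrank ℂ U01 + Module.finrank ℂ U02 := by
  have hcap := capture_of_symmetric_pieces U01 U02 ⊥ W hWs hWd (fun μ hμ => by
    obtain ⟨A, B, C, hA, hB, hC, hT⟩ := L3_finite_form U01 U02 ⊥ (hWc μ hμ)
    have hC0 : ∀ p, C p = 0 := fun p => (Submodule.mem_bot ℂ).mp (hC p)
    have hT' : ∀ p q r, contractZ μ p q r = A r p q + B q p r := fun p q r => by
      rw [hT p q r, hC0 p]; simp
    -- the `(0 1)` slot symmetry of the obligation makes the placed `B` fully symmetric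
    have hBsym : ∀ p q r, B q p r = B p q r := by
      intro p q r
      have h := contractZ_swap12 μ p q r
      rw [hT', hT', hs01 _ (hA r) q p] at h
      linear_combination -h
    refine ⟨fun p q r => A r p q, fun p q r => B q p r, 0, placed01_mem_L3 U01 ⊥ ⊥ A hA,
      placed02_mem_L3 ⊥ U02 ⊥ B hB, Submodule.zero_mem _, fun p q r => ?_, fun p q r => rfl, ?_⟩
    · show B q p r = B r p q
      rw [hBsym p q r, hs02 _ (hB p) q r, ← hBsym p r q]
    · funext p q r
      simp only [Pi.add_apply, Pi.zero_apply, add_zero]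
      exact hT' p q r)
  refine hcap.trans ?_
  rw [sup_bot_eq]
  exact Submodule.finrank_add_le_finrank_add_finrank U01 U02

end LaplaceFiveSeparatedCapture

end Summit.ValiantsHypothesis.ValiantsHypothesis.Theorems.RigidityForcesSymmetryRankRigidMinimalRepr
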